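import Summits.BirchSwinnertonDyer.Rank1Residual.GaloisImage.SelmerPairCounting
import HarnessLib

/-!
# Route `KolyvaginRoadThree`, deciding crux `ZhangSharpFrameAtThreeHL` (item stmt-BirchSwinnertonDyer-19574):
# PT road, step (R) part 2 — the PAIR-COUNTING form of Poitou–Tate for `𝓕 ≤ 𝓖` with the Selmer-complement
# hypothesis asked FOR THIS PAIR ONLY (cell `bsd-stepL`, ACCEL seat `bsd-stepL-koly3b` g10;
# `--supports stmt-BirchSwinnertonDyer-19574`, helper)

HONEST FRAMING. Theorems only; 0 definitions, 0 named facts, 0 `sorry`; CONDITIONAL on the displayed hypotheses;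
proves no case of Poitou–Tate duality by itself and no case of BSD; closes nothing (T7). PARTITION: O2@3 (B10) × A1 ×
crux 19574 × stub PT's consumer chain — proves-glue.

WHAT. n1011's `GaloisImage.card_selmerGroup_pair` (relative Greenberg–Wiles formula
`#H¹_𝓖 · #H¹_{𝓕*} · ∏_T #𝓕_v = #H¹_𝓕 · #H¹_{𝓖*} · ∏_T #𝓖_v`) takes the ∀-MODULE property `inv.SelmerComplement`
(Howard 2004 Thm. 2.1.11 for every finite module, every admissible `S`, every pair) — the one place where the named fact
`poitouTate_selmerStructure_duality K` enters the S2-ENGINE chain of crux 19574 — but USES only inclusion (ii) for the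
module `M` at hand, at `S = S(T)`, for the pair `𝓕 ≤ 𝓖` at hand. This file re-proves the two statements with exactly
that instance as the hypothesis (`hii`):
* `annRight_map_locPi_sup_at` — `(loc_T H¹_𝓖 + ∏𝓕_v)^⊥ = loc_T H¹_{𝓕*} + ∏𝓖_v^*`;
* `card_selmerGroup_pair_at` — the pair-counting identity.
Proof bodies = n1011's verbatim with `(hcompl ρ hM S hS 𝓕 𝓖 hle h𝓕 h𝓖).2` replaced by `hii`. With part 1
(`PTAt.selmerComplementAt_canonical_of_middleExact`) the instance is supplied by Milne I 4.10(b) for `M` alone, which for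
`M = E[3]` is what the owner's PT road proves.

References: [cite: Howard2004HeegnerKolyvagin, Thm. 2.1.11 (arXiv:1202.6340 p. 6)] [cite: MilneADT2006, Ch. I, Thm. 4.10]
[cite: MazurRubin2004, Prop. 2.3.5] [cite: DarmonDiamondTaylor1995, Thm. 2.19].
-/
noncomputable section

open scoped Classical NumberField
open Function NumberField IsDedekindDomain
open Literature.NumberTheory.GaloisRepresentations Literature.NumberTheory.GaloisRepresentations.DiscreteGaloisModule
  Literature.NumberTheory.GaloisCohomology
open Summit.BirchSwinnertonDyer.Rank1Residual.X11b.FiniteDuality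
open Summit.BirchSwinnertonDyer.Rank1Residual.GaloisImage

universe u

namespace Summit.BirchSwinnertonDyer.Rank1Residual.X11b.Three.Koly.PTAt

variable {K : Type u} [Field K] [NumberField K] {n : ℕ}
variable {M : Type u} [AddCommGroup M] [TopologicalSpace M] [DiscreteTopology M] [Finite M]

variable (ρ : DiscreteGaloisModule K M) (T : Finset (HeightOneSpectrum (𝓞 K))) (inv : LocalInvariants K n)

/-- **Exact annihilators `(loc_T(H¹_𝓖) + ∏_{v∈T} 𝓕_v)^⊥ = loc_T(H¹_{𝓕*}) + ∏_{v∈T} 𝓖_v^*`** for `𝓕 ≤ 𝓖` unramified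
outside `S(T)`, equal at the infinite places, `M` killed by `n` — `⊇` from the Poitou–Tate vanishing (`SumLocalTermEqZero`),
`⊆` from inclusion (ii) of Howard's Thm. 2.1.11 FOR THIS PAIR at `S(T)` (hypothesis `hii`). n1011's
`annRight_map_locPi_sup` with the ∀-module `SelmerComplement` replaced by that single instance.
[cite: Howard2004HeegnerKolyvagin, Thm. 2.1.11 (arXiv:1202.6340 p. 6)] [cite: MilneADT2006, Ch. I, Thm. 4.10] -/
theorem annRight_map_locPi_sup_at (hsum : inv.SumLocalTermEqZero) (hM : ∀ m : M, n • m = 0)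
    {𝓕 𝓖 : SelmerStructure ρ} (hle : 𝓕 ≤ 𝓖) (h𝓕 : 𝓕.IsUnramifiedOutside (finSupport T))
    (h𝓖 : 𝓖.IsUnramifiedOutside (finSupport T))
    (hinf : ∀ w : InfinitePlace K, 𝓕 (Sum.inl w) = 𝓖 (Sum.inl w))
    (hii : ∀ u : Π v : Place K, galoisCohomology ((ρ.tateDual n).toLocal v) 1,
      (∀ v ∈ finSupport T, u v ∈ inv.dualSelmerStructure ρ 𝓕 v) →
      (∀ x ∈ 𝓖.selmerGroup,
        ∑ v ∈ finSupport T, localTatePairingZMod ρ n v (inv v)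
          (galoisCohomology.localization ρ v 1 x) (u v) = 0) →
      ∃ y ∈ (inv.dualSelmerStructure ρ 𝓕).selmerGroup,
        ∀ v ∈ finSupport T, galoisCohomology.localization (ρ.tateDual n) v 1 y - u v ∈
          inv.dualSelmerStructure ρ 𝓖 v) :
    annRight (piPairing ρ T inv) ((𝓖.selmerGroup.map (locPi ρ T)) ⊔ piCond ρ T 𝓕) =
      ((inv.dualSelmerStructure ρ 𝓕).selmerGroup.map (locPi (ρ.tateDual n) T)) ⊔
        piCond (ρ.tateDual n) T (inv.dualSelmerStructure ρ 𝓖) := by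
  have hout : ∀ v ∉ finSupport T, 𝓖 v ≤ 𝓕 v := by
    intro v hv
    rcases v with w | w
    · exact absurd (inl_mem_finSupport T w) hv
    · rw [inr_mem_finSupport_iff] at hv
      rw [h𝓕.2 w (by simpa using hv), h𝓖.2 w (by simpa using hv)]
  apply le_antisymm
  · -- `⊆`: inclusion (ii) for this pair
    intro u hu
    rw [mem_annRight_iff] at hu
    -- `u ∈ ∏ 𝓕_v^*`
    have huF : u ∈ piCond (ρ.tateDual n) T (inv.dualSelmerStructure ρ 𝓕) := by
      rw [← annRight_piCond ρ T inv 𝓕, mem_annRight_iff]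
      exact fun t ht => hu t (AddSubgroup.mem_sup_right ht)
    -- extend `u` by zero to all places
    let u' : Π v : Place K, galoisCohomology ((ρ.tateDual n).toLocal v) 1 := fun v =>
      match v with
      | Sum.inl _ => 0
      | Sum.inr w => if hw : w ∈ T then u ⟨w, hw⟩ else 0
    have hu'inr : ∀ w (hw : w ∈ T), u' (Sum.inr w) = u ⟨w, hw⟩ := fun w hw => by
      simp only [u', dif_pos hw]
    have hu'S : ∀ v ∈ finSupport T, u' v ∈ inv.dualSelmerStructure ρ 𝓕 v := by
      intro v hv
      rcases v with w | w
      · exact zero_mem _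
      · rw [inr_mem_finSupport_iff] at hv
        rw [hu'inr w hv]
        exact (mem_piCond_iff _ T _ u).mp huF ⟨w, hv⟩
    have hu'orth : ∀ x ∈ 𝓖.selmerGroup,
        ∑ v ∈ finSupport T, localTatePairingZMod ρ n v (inv v)
          (galoisCohomology.localization ρ v 1 x) (u' v) = 0 := by
      intro x hx
      rw [sum_finSupport]
      have h0 : ∑ w : InfinitePlace K, localTatePairingZMod ρ n (Sum.inl w) (inv (Sum.inl w))
          (galoisCohomology.localization ρ (Sum.inl w) 1 x) (u' (Sum.inl w)) = 0 :=
        Finset.sum_eq_zero fun w _ => by simp only [u', map_zero]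
      rw [h0, zero_add]
      have := hu (locPi ρ T x) (AddSubgroup.mem_sup_left ⟨x, hx, rfl⟩)
      rw [piPairing_apply] at this
      rw [← this, ← Finset.sum_coe_sort T]
      exact Finset.sum_congr rfl fun w _ => by rw [hu'inr w.1 w.2, locPi_apply]
    obtain ⟨y, hy, hyu⟩ := hii u' hu'S hu'orth
    -- `u = loc_T y - g` with `g ∈ ∏ 𝓖_v^*`
    rw [AddSubgroup.mem_sup]
    refine ⟨locPi (ρ.tateDual n) T y, ⟨y, hy, rfl⟩, u - locPi (ρ.tateDual n) T y, ?_, by abel⟩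
    rw [mem_piCond_iff]
    intro w
    have := hyu (Sum.inr w.1) ((inr_mem_finSupport_iff T w.1).mpr w.2)
    rw [hu'inr w.1 w.2] at this
    rw [Pi.sub_apply, locPi_apply, ← neg_sub, neg_mem_iff]
    exact this
  · -- `⊇`: the Poitou–Tate vanishing and the definition of the dual conditions
    apply sup_le
    · rintro _ ⟨y, hy, rfl⟩
      rw [mem_annRight_iff]
      intro s hs
      rw [AddSubgroup.mem_sup] at hs
      obtain ⟨_, ⟨x, hx, rfl⟩, t, ht, rfl⟩ := hs
      rw [map_add, AddMonoidHom.add_apply]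
      have h1 : piPairing ρ T inv (locPi ρ T x) (locPi (ρ.tateDual n) T y) = 0 := by
        have hvan := hsum.sum_localTerm_selmer_eq_zero ρ hM (S := finSupport T) hout hx hy
        rw [sum_finSupport] at hvan
        have h0 : ∑ w : InfinitePlace K, inv.localTerm ρ (Sum.inl w) x y = 0 :=
          Finset.sum_eq_zero fun w _ =>
            inv.localTerm_eq_zero_of_mem_of_mem_dual ρ (Sum.inl w) (𝓕 (Sum.inl w))
              (by rw [hinf w]; exact (SelmerStructure.mem_selmerGroup_iff _ _).mp hx _)
              ((SelmerStructure.mem_selmerGroup_iff _ _).mp hy _)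
        rw [h0, zero_add] at hvan
        rw [piPairing_apply, ← hvan, ← Finset.sum_coe_sort T]
        exact Finset.sum_congr rfl fun w _ => by rw [locPi_apply, locPi_apply, LocalInvariants.localTerm_apply]; rfl
      have h2 : piPairing ρ T inv t (locPi (ρ.tateDual n) T y) = 0 := by
        rw [piPairing_apply]
        refine Finset.sum_eq_zero fun w _ => ?_
        have hyw := (SelmerStructure.mem_selmerGroup_iff _ _).mp hy (Sum.inr w.1)
        rw [LocalInvariants.dualSelmerStructure_apply, LocalInvariants.mem_dualLocalCondition_iff] at hyw
        rw [locPi_apply]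
        exact hyw _ ((mem_piCond_iff ρ T 𝓕 t).mp ht w)
      rw [h1, h2, add_zero]
    · rw [← annRight_piCond ρ T inv 𝓖]
      exact annRight_anti _ (sup_le (AddSubgroup.map_le_iff_le_comap.mpr fun x hx => by
        rw [AddSubgroup.mem_comap, mem_piCond_iff]
        exact fun w => (SelmerStructure.mem_selmerGroup_iff _ _).mp hx _) (piCond_mono ρ T hle))

/-- **The pair-counting form of Poitou–Tate duality for `𝓕 ≤ 𝓖` with Howard's inclusion (ii) asked for this pair only**
(relative Greenberg–Wiles formula): for Selmer structures `𝓕 ≤ 𝓖` on a finite `Γ_K`-module `M` killed by `n`, both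
unramified outside `S(T) = ∞ ∪ T`, equal at the infinite places, a family `inv` perfect at the finite places with the Poitou–Tate vanishing (`IsPerfect`, `SumLocalTermEqZero`), and
inclusion (ii) of Howard's Thm. 2.1.11 for `(𝓕, 𝓖)` at `S(T)` (`hii`):
`#H¹_𝓖(K,M) · #H¹_{𝓕*}(K,M^D) · ∏_{v∈T} #𝓕_v = #H¹_𝓕(K,M) · #H¹_{𝓖*}(K,M^D) · ∏_{v∈T} #𝓖_v`. n1011's
`card_selmerGroup_pair` with the ∀-module `SelmerComplement` replaced by that single instance (its admissibility
hypothesis `hS` on `T`, used there only to invoke the ∀-module fact, is no longer needed).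
[cite: Howard2004HeegnerKolyvagin, Thm. 2.1.11 (arXiv:1202.6340 p. 6)] [cite: MilneADT2006, Ch. I, Thm. 4.10]
[cite: DarmonDiamondTaylor1995, Thm. 2.19] -/
theorem card_selmerGroup_pair_at [NeZero n] (hperf : inv.IsPerfect) (hsum : inv.SumLocalTermEqZero)
    (hM : ∀ m : M, n • m = 0)
    {𝓕 𝓖 : SelmerStructure ρ} (hle : 𝓕 ≤ 𝓖) (h𝓕 : 𝓕.IsUnramifiedOutside (finSupport T))
    (h𝓖 : 𝓖.IsUnramifiedOutside (finSupport T))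
    (hinf : ∀ w : InfinitePlace K, 𝓕 (Sum.inl w) = 𝓖 (Sum.inl w))
    (hii : ∀ u : Π v : Place K, galoisCohomology ((ρ.tateDual n).toLocal v) 1,
      (∀ v ∈ finSupport T, u v ∈ inv.dualSelmerStructure ρ 𝓕 v) →
      (∀ x ∈ 𝓖.selmerGroup,
        ∑ v ∈ finSupport T, localTatePairingZMod ρ n v (inv v)
          (galoisCohomology.localization ρ v 1 x) (u v) = 0) →
      ∃ y ∈ (inv.dualSelmerStructure ρ 𝓕).selmerGroup,
        ∀ v ∈ finSupport T, galoisCohomology.localization (ρ.tateDual n) v 1 y - u v ∈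
          inv.dualSelmerStructure ρ 𝓖 v) :
    Nat.card 𝓖.selmerGroup * Nat.card (inv.dualSelmerStructure ρ 𝓕).selmerGroup *
        ∏ v ∈ T, Nat.card (𝓕 (Sum.inr v)) =
      Nat.card 𝓕.selmerGroup * Nat.card (inv.dualSelmerStructure ρ 𝓖).selmerGroup *
        ∏ v ∈ T, Nat.card (𝓖 (Sum.inr v)) := by
  haveI : Finite (TateDual K M n) := DiscreteGaloisModule.TateDual.finite (K := K) (M := M) n
  -- places off `T`
  have houtT : ∀ v : Place K, (∀ w ∈ T, v ≠ Sum.inr w) → 𝓕 v = 𝓖 v := by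
    intro v hv
    rcases v with w | w
    · exact hinf w
    · have hw : w ∉ T := fun h => hv w h rfl
      rw [h𝓕.2 w (by simpa using hw), h𝓖.2 w (by simpa using hw)]
  -- the dual structures: `𝓖* ≤ 𝓕*`, unramified outside `S(T)`, equal at infinite places
  have hle' : inv.dualSelmerStructure ρ 𝓖 ≤ inv.dualSelmerStructure ρ 𝓕 :=
    inv.dualSelmerStructure_anti ρ hle
  have houtT' : ∀ v : Place K, (∀ w ∈ T, v ≠ Sum.inr w) →
      inv.dualSelmerStructure ρ 𝓖 v = inv.dualSelmerStructure ρ 𝓕 v := by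
    intro v hv
    rw [LocalInvariants.dualSelmerStructure_apply, LocalInvariants.dualSelmerStructure_apply, houtT v hv]
  -- (1) and its dual
  have h1 := card_selmerGroup_mul_card_piCond ρ T hle houtT
  have h1' := card_selmerGroup_mul_card_piCond (ρ.tateDual n) T hle' houtT'
  -- (2)
  have h2 := annRight_map_locPi_sup_at ρ T inv hsum hM hle h𝓕 h𝓖 hinf hii
  -- (3) counting with the perfect pairing
  have hflip := piPairing_flip_bijective ρ T inv hperf hM
  have hA := nsmul_pi_galoisCohomology_eq_zero ρ T hM
  have h3 := natCard_annRight_mul hA (piPairing ρ T inv) hflip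
    ((𝓖.selmerGroup.map (locPi ρ T)) ⊔ piCond ρ T 𝓕)
  rw [h2] at h3
  have h4 := natCard_annRight_mul hA (piPairing ρ T inv) hflip (piCond ρ T 𝓖)
  rw [annRight_piCond] at h4
  -- assemble: all in `ℕ`, cancel the positive factor `#∏𝓖_v^* · #(loc H¹_𝓖 + ∏𝓕_v)`
  rw [← card_piCond ρ T 𝓕, ← card_piCond ρ T 𝓖]
  have hIpos : 0 < Nat.card ↥((𝓖.selmerGroup.map (locPi ρ T)) ⊔ piCond ρ T 𝓕) := Nat.card_pos
  have hGpos : 0 < Nat.card (piCond (ρ.tateDual n) T (inv.dualSelmerStructure ρ 𝓖)) := Nat.card_pos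
  have key : Nat.card 𝓖.selmerGroup * Nat.card (inv.dualSelmerStructure ρ 𝓕).selmerGroup *
      Nat.card (piCond ρ T 𝓕) *
      (Nat.card (piCond (ρ.tateDual n) T (inv.dualSelmerStructure ρ 𝓖)) *
        Nat.card ↥((𝓖.selmerGroup.map (locPi ρ T)) ⊔ piCond ρ T 𝓕)) =
      Nat.card 𝓕.selmerGroup * Nat.card (inv.dualSelmerStructure ρ 𝓖).selmerGroup *
      Nat.card (piCond ρ T 𝓖) *
      (Nat.card (piCond (ρ.tateDual n) T (inv.dualSelmerStructure ρ 𝓖)) *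
        Nat.card ↥((𝓖.selmerGroup.map (locPi ρ T)) ⊔ piCond ρ T 𝓕)) := by
    calc _ = (Nat.card 𝓖.selmerGroup * Nat.card (piCond ρ T 𝓕)) *
          (Nat.card (inv.dualSelmerStructure ρ 𝓕).selmerGroup *
            Nat.card (piCond (ρ.tateDual n) T (inv.dualSelmerStructure ρ 𝓖))) *
          Nat.card ↥((𝓖.selmerGroup.map (locPi ρ T)) ⊔ piCond ρ T 𝓕) := by ring
      _ = (Nat.card 𝓕.selmerGroup * Nat.card ↥((𝓖.selmerGroup.map (locPi ρ T)) ⊔ piCond ρ T 𝓕)) *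
          (Nat.card (inv.dualSelmerStructure ρ 𝓖).selmerGroup *
            Nat.card ↥(((inv.dualSelmerStructure ρ 𝓕).selmerGroup.map (locPi (ρ.tateDual n) T)) ⊔
              piCond (ρ.tateDual n) T (inv.dualSelmerStructure ρ 𝓖))) *
          Nat.card ↥((𝓖.selmerGroup.map (locPi ρ T)) ⊔ piCond ρ T 𝓕) := by rw [h1, h1']
      _ = Nat.card 𝓕.selmerGroup * Nat.card (inv.dualSelmerStructure ρ 𝓖).selmerGroup *
          (Nat.card ↥(((inv.dualSelmerStructure ρ 𝓕).selmerGroup.map (locPi (ρ.tateDual n) T)) ⊔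
              piCond (ρ.tateDual n) T (inv.dualSelmerStructure ρ 𝓖)) *
            Nat.card ↥((𝓖.selmerGroup.map (locPi ρ T)) ⊔ piCond ρ T 𝓕)) *
          Nat.card ↥((𝓖.selmerGroup.map (locPi ρ T)) ⊔ piCond ρ T 𝓕) := by ring
      _ = Nat.card 𝓕.selmerGroup * Nat.card (inv.dualSelmerStructure ρ 𝓖).selmerGroup *
          (Nat.card (piCond (ρ.tateDual n) T (inv.dualSelmerStructure ρ 𝓖)) *
            Nat.card (piCond ρ T 𝓖)) *
          Nat.card ↥((𝓖.selmerGroup.map (locPi ρ T)) ⊔ piCond ρ T 𝓕) := by rw [h3, h4]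
      _ = _ := by ring
  exact Nat.eq_of_mul_eq_mul_right (Nat.mul_pos hGpos hIpos) key

end Summit.BirchSwinnertonDyer.Rank1Residual.X11b.Three.Koly.PTAt

end
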